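import Literature.Topology.FourManifolds.LadderCoreConnected
import Literature.Topology.FourManifolds.ThickenedPlanarCore
import Literature.Topology.FourManifolds.RegularSublevelBallForm
import HarnessLib

/-!
# The core body `Z₀ = {q₀ + z² + w² ≤ 0} ⊂ ℝ⁴` of the cut ladder is a smoothly embedded `4`-ball

Topic `Literature/Topology/FourManifolds`; the assembly of brick E1 of the constructive road (P1′),
route M, to `Literature.Topology.FourManifolds.Trisection.isConnectedSum_of_reducing_separating`
(`ReducibleTrisectionSplitting.lean`, § Status), on top of `LadderCore.lean` (the planar core
function `q₀` with `k + 1` minima and `k` saddles below `0`), `LadderCoreConnected.lean`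
(`{q₀ ≤ 0}` is connected), `ThickenedPlanarCore.lean` (thickenings of planar core functions:
handle counts, normalisation on connected bodies, the ball case by the classification of
`1`-handlebodies) and `RegularSublevelBallForm.lean` (a regular sublevel set diffeomorphic to
the disc is an embedded ball):

* `isPlanarCoreMorseFunction_core : IsPlanarCoreMorseFunction (k + 1) k P.core 0`;
* `CoreBody` — the regular sublevel set `{G₀ ≤ 0}`, `G₀ = q₀ + z² + w²` (`coreG`): a compact
  `4`-manifold with boundary the smooth level `Σ = {G₀ = 0}`;
* `isConnected_coreG_preimage`, `connectedSpace_coreBody`: **`Z₀` is connected** (Reeb's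
  argument in `ℝ⁴` with the lifted spine);
* `hasHandleDecomposition_coreBody : HasHandleDecomposition 3 CoreBody (handleCount 1 0)`
  (cancel the `k` pockets against the `k` rung saddles),
  `nonempty_diffeomorph_coreBody_closedBall : Z₀ ≃ₘ 𝔻⁴`, and
* `exists_ball_coreBody` (**main**): a smooth embedding `E : ℝ⁴ → ℝ⁴` with `E(𝕊³) = Σ`,
  `E(𝔻⁴) = Z₀`, `E(𝔹⁴) = {G₀ < 0}` — so `Σ` is a smooth `3`-sphere inside the ladder body with an
  explicit bicollar `t ↦ E((1 + t) θ)`, and Alexander's theorem in `𝕊³` applies to spheres in `Σ`.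

Everything is **proved**; no named fact is introduced.

## References
* J. Milnor, *Morse theory* (1963), §3 and proof of Thm. 4.1. [Milnor1963]
* A. Juhász, *Differential and Low-Dimensional Topology* (2023), proof of Thm. 2.7, Step 1.
  [Juhasz2023]
* A. A. Kosinski, *Differential Manifolds* (1993), VI (11.4). [Kosinski1993]
-/

noncomputable section

open scoped Topology ContDiff Manifold
open Set Filter Real

namespace Literature.Topology.FourManifolds

/-- Local notation: `𝔼 n` is the model Euclidean space `EuclideanSpace ℝ (Fin n)`. -/
local notation "𝔼 " n:arg => EuclideanSpace ℝ (Fin n)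

open PlanarThickening SolidThickening

namespace Ladder.Params

variable {k : ℕ} (P : Params k)

/-! ### §1 The core presents a planar domain with `k + 1` minima and `k` saddles below `0` -/

/-- **The core function is a planar core Morse function of type `(k + 1, k)` at the level `0`.**
[folklore] -/
theorem isPlanarCoreMorseFunction_core : IsPlanarCoreMorseFunction (k + 1) k P.core 0 where
  isMorse := P.isMorse_core
  exists_bound := ⟨_, P.norm_sq_le_core⟩
  finite_criticalSet := P.finite_criticalSet_core
  apply_ne := fun _ hu => P.core_ne_zero_of_isMCriticalPt hu
  ncard_index_zero := P.ncard_criticalSetOfIndex_core_zero_inter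
  ncard_index_one := P.ncard_criticalSetOfIndex_core_one_inter
  lt_of_index_two := fun _ hu => P.core_pos_of_index_two hu

/-- **The core body** `Z₀ = {q₀(x, y) + z² + w² ≤ 0} ⊂ ℝ⁴` (a compact `4`-manifold with boundary
with `k + 1` `0`-handles and `k` `1`-handles, `ThickenedPlanarCore.lean`). [folklore] -/
abbrev CoreBody : Type := P.isPlanarCoreMorseFunction_core.FourThickening

/-- The function `G₀ = q₀ + z² + w²` whose sublevel set is the core body. [folklore] -/
abbrev coreG : 𝔼 4 → ℝ := thicken₄ (thicken P.core)

/-! ### §2 The core body is connected -/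

/-- The lifted spine `ι₃(ι(spine)) ⊂ ℝ⁴`. [folklore] -/
def spine₄ : Set (𝔼 4) := lift₃ '' (lift '' P.spine)

/-- **`{G₀ ≤ 0}` is connected**: its critical points of index `0` are the lifts of the cap minimum
and of the pockets, all on the lifted spine, which is preconnected and lies in `{G₀ ≤ 0}`.
[cite: Milnor1963, §3 and proof of Thm. 4.1] -/
theorem isConnected_coreG_preimage : IsConnected (P.coreG ⁻¹' Iic 0) := by
  have hPC := P.isPlanarCoreMorseFunction_core
  have hM : IsMorse (𝓡 4) P.coreG := hPC.isMorse_and_apply_ne.1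
  have hq2 : ContDiff ℝ 2 P.core := P.contDiff_core.of_le (by norm_cast)
  have ht2 : ContDiff ℝ 2 (thicken P.core) := (contDiff_thicken P.contDiff_core).of_le (by norm_cast)
  have hK : IsCompact (P.coreG ⁻¹' Iic 0) := isCompact_iff_compactSpace.2 (inferInstance : CompactSpace P.CoreBody)
  refine isConnected_preimage_Iic_of_isCompact_of_subset (n := 3) (hM.1.of_le (by norm_cast)) hK
    (S := P.spine₄) ?_ ?_ ?_ ⟨lift₃ (lift (pt (-P.t₀) 0)), ?_⟩
  · exact (P.isPreconnected_spine.image _ lift.continuous.continuousOn).image _ lift₃.continuous.continuousOn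
  · rintro _ ⟨_, ⟨u, hu, rfl⟩, rfl⟩
    show thicken₄ (thicken P.core) (lift₃ (lift u)) ≤ 0
    rw [thicken₄_lift₃, thicken_lift]
    exact P.spine_subset hu
  · rw [show P.coreG = thicken₄ (thicken P.core) from rfl, criticalSetOfIndex_thicken₄_inter ht2,
      criticalSetOfIndex_thicken_inter hq2]
    exact image_mono (image_mono P.criticalSetOfIndex_core_zero_inter_subset_spine)
  · show thicken₄ (thicken P.core) (lift₃ (lift (pt (-P.t₀) 0))) ≤ 0
    rw [thicken₄_lift₃, thicken_lift]
    exact P.core_cap_lt.le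

/-- **The core body is connected.** [folklore] -/
instance connectedSpace_coreBody : ConnectedSpace P.CoreBody :=
  isConnected_iff_connectedSpace.1 P.isConnected_coreG_preimage

/-! ### §3 The core body is a `4`-ball, in embedded form -/

/-- **The core body has a handle decomposition with one `0`-handle and no `1`-handle.**
[cite: Juhasz2023, proof of Thm. 2.7, Step 1] -/
theorem hasHandleDecomposition_coreBody : HasHandleDecomposition 3 P.CoreBody (handleCount 1 0) :=
  P.isPlanarCoreMorseFunction_core.hasHandleDecomposition_handleCount_one (r := k) (s' := 0) rfl (by ring)

/-- **The core body is diffeomorphic to the closed `4`-ball.** [cite: Kosinski1993, VI (11.4)(c)] -/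
theorem nonempty_diffeomorph_coreBody_closedBall :
    Nonempty (P.CoreBody ≃ₘ⟮𝓡∂ 4, 𝓡∂ 4⟯ Metric.closedBall (0 : 𝔼 4) 1) :=
  P.isPlanarCoreMorseFunction_core.nonempty_diffeomorph_closedBall (r := k) rfl rfl

/-- **The core body is a smoothly embedded `4`-ball**: a smooth embedding `E : ℝ⁴ → ℝ⁴` with
`E(𝕊³) = {G₀ = 0}` (the smooth level `3`-sphere `Σ`), `E(𝔻⁴) = {G₀ ≤ 0} = Z₀` and
`E(𝔹⁴) = {G₀ < 0}` (`RegularSublevel.exists_ball_of_diffeomorph_closedBall`). [folklore] -/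
theorem exists_ball_coreBody :
    ∃ E : 𝔼 4 → 𝔼 4, Manifold.IsSmoothEmbedding (𝓡 4) (𝓡 4) ∞ E ∧
      E '' Metric.sphere 0 1 = P.coreG ⁻¹' {0} ∧ E '' Metric.closedBall 0 1 = {z | P.coreG z ≤ 0} ∧
        E '' Metric.ball 0 1 = {z | P.coreG z < 0} := by
  obtain ⟨Ψ⟩ := P.nonempty_diffeomorph_coreBody_closedBall
  exact RegularSublevel.exists_ball_of_diffeomorph_closedBall _ Ψ

end Ladder.Params

end Literature.Topology.FourManifolds
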